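import Literature.AlgebraicGeometry.Shioda1982.ExceptionalQuadruplesComplete
import HarnessLib

/-!
# Shioda 1982 / Meyer–Neutsch 1981: Tabelle 1 is complete at the levels `N = 120, 156` (kernel-checked exhaustion)

Topic `Literature/AlgebraicGeometry/Shioda1982`; companion of `ExceptionalQuadruplesComplete.lean`, which holds the search procedure
`checkB`, its soundness theorem `tabelleOneCompleteAt_of_chunks`, the invariant form `exists_mem_reps_of_isExceptionalQuadruple`,
the statement `TabelleOneCompleteAt`, and the 19 levels `N ≤ 90` (see its module docstring for sources, method and the honest
framing). THEOREMS only (no definition, no named fact): here the level(s) `N = 120, 156` of [MeyerNeutsch1981Fermatquadrupel, Tabelle 1]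
— `N = 120`: 5 printed orbits, 72 multisets; `N = 156`: 1 orbit, 24 multisets — each chunk `checkB N a₀ len = true` evaluated by `decide +kernel` (no `native_decide`), the first entry `a` split into
chunks only to bound the memory of a single kernel evaluation (`120`: 2 chunks, `156`: 3 chunks; ≈ 1.6·10⁵ candidate triples). An independent plain-Python enumeration of the same statement
(cell `pub-hfermat`, `code/complete_check.py`) agrees (0 counterexamples; 72 resp. 24 exceptional multisets = the printed orbit sizes).

HONEST FRAMING (cell `pub-hfermat`): explicit algebraic cycles for specific Hodge classes on Fermat/Delsarte varieties; residual open
instances listed; no claim on general Hodge. These classes are algebraic (Lefschetz (1,1)); certified here is only the completeness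
of the printed list at these levels. [Aoki1983, Thm. C] (none for `N > 180`) is a printed theorem, not vendored.

## References
* [MeyerNeutsch1981Fermatquadrupel] W. Meyer, W. Neutsch, *Fermatquadrupel*, Math. Ann. 256 (1981) 51–62, §2 p. 53, Tabelle 1 p. 54.
* [Shioda1982PicardFermat] T. Shioda, J. Fac. Sci. Univ. Tokyo IA 28 (1982) 725–734, table p. 727.
* [Terasoma2018OpenFermat] T. Terasoma, arXiv:1801.01251, §6.
* [Aoki1983] N. Aoki, Math. Ann. 266 (1983) 23–54, Thm. C.
-/

namespace Literature.AlgebraicGeometry.Shioda1982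

open Literature.AlgebraicGeometry.HodgeTheory

set_option maxHeartbeats 0 in
/-- **Tabelle 1 is complete at `N = 120`** (5 printed orbit(s), `72` multisets): every sorted Hodge 4-multiset mod `120`
without a pair and with `gcd = 1` is standard or a unit multiple of a printed representative. Kernel exhaustion (`checkB`). `2` chunks of first entries `a`.
[cite: MeyerNeutsch1981Fermatquadrupel, Tabelle 1 p. 54 (N = 120), §2 p. 53] [cite: Shioda1982PicardFermat, table p. 727 (row m = 120)] -/
theorem completeAt_oneHundredTwenty : TabelleOneCompleteAt 120 :=
  tabelleOneCompleteAt_of_chunks 120 [(0, 35), (35, 85)] (by decide +kernel) (by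
    intro p hp
    simp only [List.mem_cons, List.not_mem_nil, or_false] at hp
    rcases hp with rfl | rfl <;> decide +kernel)

/-- Every exceptional quadruple of level `120` is a unit multiple of one of the 5 representative(s) printed in Tabelle 1.
[cite: MeyerNeutsch1981Fermatquadrupel, Tabelle 1 p. 54 (N = 120)] [cite: Terasoma2018OpenFermat, §6 (m = 120)] -/
theorem exceptional_complete_oneHundredTwenty (s : Multiset (ZMod 120)) (hs : IsExceptionalQuadruple 120 s) :
    ∃ r ∈ reps 120, ∃ t : (ZMod 120)ˣ, s = r.map (fun x ↦ (t : ZMod 120) * x) :=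
  exists_mem_reps_of_isExceptionalQuadruple completeAt_oneHundredTwenty hs

set_option maxHeartbeats 0 in
/-- **Tabelle 1 is complete at `N = 156`** (1 printed orbit(s), `24` multisets): every sorted Hodge 4-multiset mod `156`
without a pair and with `gcd = 1` is standard or a unit multiple of a printed representative. Kernel exhaustion (`checkB`). `3` chunks of first entries `a`.
[cite: MeyerNeutsch1981Fermatquadrupel, Tabelle 1 p. 54 (N = 156), §2 p. 53] [cite: Shioda1982PicardFermat, table p. 727 (row m = 156)] -/
theorem completeAt_oneHundredFiftySix : TabelleOneCompleteAt 156 :=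
  tabelleOneCompleteAt_of_chunks 156 [(0, 19), (19, 20), (39, 117)] (by decide +kernel) (by
    intro p hp
    simp only [List.mem_cons, List.not_mem_nil, or_false] at hp
    rcases hp with rfl | rfl | rfl <;> decide +kernel)

/-- Every exceptional quadruple of level `156` is a unit multiple of one of the 1 representative(s) printed in Tabelle 1.
[cite: MeyerNeutsch1981Fermatquadrupel, Tabelle 1 p. 54 (N = 156)] [cite: Terasoma2018OpenFermat, §6 (m = 156)] -/
theorem exceptional_complete_oneHundredFiftySix (s : Multiset (ZMod 156)) (hs : IsExceptionalQuadruple 156 s) :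
    ∃ r ∈ reps 156, ∃ t : (ZMod 156)ˣ, s = r.map (fun x ↦ (t : ZMod 156) * x) :=
  exists_mem_reps_of_isExceptionalQuadruple completeAt_oneHundredFiftySix hs

end Literature.AlgebraicGeometry.Shioda1982
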